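import Summits.BirchSwinnertonDyer.BirchSwinnertonDyer.Theorems.GenusKolyvaginAtTwoGenusPrimitiveSupplyAtTwoTwistingPrimeDepthKolyvagin
import HarnessLib

/-!
# Route `GenusKolyvaginAtTwo`, crux #2 `GenusPrimitiveSupplyAtTwo` (stmt-BirchSwinnertonDyer-22136):
# depth ONE recovered, and the KUMMER reading of non-entanglement

Width seat `bsd-line-gk2-p4` g8, cell `bsd-f1-sign2`; helper (`--supports stmt-BirchSwinnertonDyer-22136`),
ninth file of the twisting-prime series (after `…TwistingPrimeDepthKolyvagin`). THEOREMS ONLY: no definition,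
no named fact, no `sorry`; no item is closed; BSD is not proved by any of this.

* §20 the discharge lemmas at `M = 1` (`exists_selmer_h1Eval_ne_of_card_ne_one`,
  `exists_selmer_h1Eval_ne_twist_of_card_ne_one`: `#Sel₂ ≠ 1` suffices, by Prop. 9.1 at `2`), and the
  consistency check `exists_kolyvaginPrime_pow_one_genusPair_selmer_of_cor34i` = g7's depth-one capstone as
  the case `M = 1` of the depth-`M` one.
* §21 `coe_h1Eval_kummerClassTorsion` (`[κ(Q), ρ] = ρQ − Q`) and
  `exists_torsionFixing_h1Eval_kummerClassTorsion_ne_iff`: a Kummer class does not die on `Γ_{K(E[m])}` iff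
  some `h` fixing `E[m]` MOVES the division point `Q` — «`2Q` is not halvable over the `m`-division field».
  For the LEVEL LAW's twin (`#Sel₂ = 2`, rank one, `Sel₂ = κ(A(ℚ))`) the non-entanglement hypothesis of the
  depth-`M` capstone thus reads: the generator of `A(ℚ)/2A(ℚ)` is not halvable in `A` over `ℚ(E[2^M])`.
* §22 `exists_selmer_h1Eval_ne_twist_of_smul_half_ne` (point-level discharge of the twin hypothesis: a half `Q` of a
  rational point `P ∈ Wd(ℚ)` MOVED by `Γ_{ℚ(E[2^M])}` ⟹ `κ(P) ∈ Sel₂(Wd)` does not die there) and the point-level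
  CAPSTONE `exists_kolyvaginPrime_pow_genusPair_selmer_of_cor34i_of_half`.

References: [MazurRubin2010] Remark 2.4, Cor. 3.4 (i); [GrossLMS1991] §9; [SilvermanAEC2009] VIII.2.
-/

set_option linter.dupNamespace false -- tree convention: `Summit.BirchSwinnertonDyer.BirchSwinnertonDyer.Theorems` (summit = sub-problem)
set_option autoImplicit false

noncomputable section

open scoped Classical Pointwise

namespace Summit.BirchSwinnertonDyer.BirchSwinnertonDyer.Theorems.GenusKolyTwistingPrime

open WeierstrassCurve NumberField IsDedekindDomain Field
open Literature.NumberTheory.GaloisRepresentations Literature.NumberTheory.EllipticCurves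
open Literature.NumberTheory

/-! ## §20 Depth ONE is automatic: the discharge lemmas (so `…TwistingPrimeGenusPair` is the case `M = 1`) -/

section DepthOne

variable (W : WeierstrassCurve ℚ) [W.IsElliptic]

/-- **At `M = 1` the `W`-side hypothesis holds as soon as `#Sel₂(W) ≠ 1`** (`ρ̄_{W,2}` onto): a non-zero
Selmer class does not die on `Γ_{ℚ(E[2])}` (Prop. 9.1 at `2`). [cite: GrossLMS1991, §9 Prop. 9.1] -/
theorem exists_selmer_h1Eval_ne_of_card_ne_one (hsurj : W.HasSurjectiveModNGaloisRep 2)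
    (hS : Nat.card (W.selmerGroup 2) ≠ 1) :
    ∃ c ∈ W.selmerGroup 2, ∃ h ∈ torsionFixing W ((2 ^ 1 : ℕ) : ℤ), h1Eval W (2 : ℤ) c h ≠ 0 := by
  have hne : ∃ c ∈ W.selmerGroup 2, c ≠ 0 := by
    by_contra h
    push Not at h
    exact hS (by rw [(AddSubgroup.eq_bot_iff_forall _).mpr h, AddSubgroup.card_bot])
  obtain ⟨c, hcS, hc0⟩ := hne
  obtain ⟨h, hT, hh⟩ := exists_torsionFixing_h1Eval_ne_of_ne_zero W hsurj hc0
  exact ⟨c, hcS, h, by simpa using hT, hh⟩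

/-- **At `M = 1` the twin-side hypothesis holds as soon as `#Sel₂(Wd) ≠ 1`** (`ρ̄_{W,2}` onto, `Wd` any
elliptic model of `W^{(d)}`, `d ≠ 0`): transport a non-zero Selmer class of `Wd` to `H¹(ℚ, E[2])` along
`E^{(d)}[2] ≅ E[2]` (injective, evaluation-compatible) and apply Prop. 9.1 at `2` for `W`.
[cite: MazurRubin2010, Remark 2.4] [cite: GrossLMS1991, §9 Prop. 9.1] -/
theorem exists_selmer_h1Eval_ne_twist_of_card_ne_one (hsurj : W.HasSurjectiveModNGaloisRep 2)
    {d : ℚ} (hd : d ≠ 0) {Wd : WeierstrassCurve ℚ} [Wd.IsElliptic] {C : VariableChange ℚ}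
    (hWd : C • W.quadraticTwist d = Wd) (hS' : Nat.card (Wd.selmerGroup 2) ≠ 1) :
    ∃ c' ∈ Wd.selmerGroup 2, ∃ h ∈ torsionFixing W ((2 ^ 1 : ℕ) : ℤ), h1Eval Wd (2 : ℤ) c' h ≠ 0 := by
  have hne : ∃ c' ∈ Wd.selmerGroup 2, c' ≠ 0 := by
    by_contra h
    push Not at h
    exact hS' (by rw [(AddSubgroup.eq_bot_iff_forall _).mpr h, AddSubgroup.card_bot])
  obtain ⟨c', hcS', hc0'⟩ := hne
  obtain ⟨ψ, hψ⟩ := exists_equivariant_addEquiv_geomTorsion_two_of_twist W hd hWd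
  obtain ⟨Ψ, hinj, hΨeval, -⟩ := exists_h1Map_of_equivariant_addEquiv Wd W (2 : ℤ) ψ hψ
  have hTd : torsionFixing W (2 : ℤ) ≤ torsionFixing Wd (2 : ℤ) :=
    torsionFixing_le_of_equivariant_addEquiv Wd W (2 : ℤ) ψ hψ
  have hy : Ψ c' ≠ 0 := fun h ↦ hc0' (hinj (by rw [h, map_zero]))
  obtain ⟨h, hT, hh⟩ := exists_torsionFixing_h1Eval_ne_of_ne_zero W hsurj hy
  refine ⟨c', hcS', h, by simpa using hT, fun h0 ↦ hh ?_⟩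
  rw [hΨeval c' hT (hTd hT), h0, map_zero]

variable [W.IsGloballyMinimal] {K : Type} [Field K] [NumberField K]

/-- **Consistency check: at `M = 1` the depth-`M` capstone IS the depth-one capstone**
(`exists_kolyvaginPrime_genusPair_selmer_of_cor34i` of `…TwistingPrimeGenusPair`, now with the extra
bookkeeping `2 ∣ ℓ + 1`, `2 ∣ a_ℓ`), both non-entanglement hypotheses being discharged by §20.
[cite: MazurRubin2010, Cor. 3.4 (i), Prop. 3.3, Lemma 3.5] [cite: GrossLMS1991, §3 (3.1)–(3.3)] -/
theorem exists_kolyvaginPrime_pow_one_genusPair_selmer_of_cor34i (h34 : MazurRubin2010.cor34i_singleton_rat)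
    (hsurj : W.HasSurjectiveModNGaloisRep 2) (hΔ : W.Δ < 0) (h4 : Nat.card (W.selmerGroup 2) = 4)
    (hK : IsImaginaryQuadratic K) {Wd : WeierstrassCurve ℚ} [Wd.IsElliptic] [Wd.IsGloballyMinimal]
    {C : VariableChange ℚ} (hWd : C • W.quadraticTwist (discr K : ℚ) = Wd)
    (h2 : Nat.card (Wd.selmerGroup 2) = 2) (B₀ : Finset ℕ) :
    ∃ ℓ : ℕ, ∃ _ : Fact ℓ.Prime, ℓ ∉ B₀ ∧ ℓ % 8 = 7 ∧ IsKolyvaginPrime (W.conductorNorm ℤ) W K 2 ℓ ∧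
      FrobEqFrobInfty W K (2 ^ 1) ℓ ∧ 2 ^ 1 ∣ ℓ + 1 ∧ ((2 : ℤ) ^ 1) ∣ W.frobeniusTrace ℓ ∧
      (∀ (W₁ : WeierstrassCurve ℚ) [W₁.IsElliptic],
        (∃ C₁ : VariableChange ℚ, C₁ • W.quadraticTwist (-(ℓ : ℚ)) = W₁) →
          Nat.card (W₁.selmerGroup 2) = 2) ∧
      (∀ (W₂ : WeierstrassCurve ℚ) [W₂.IsElliptic],
        (∃ C₂ : VariableChange ℚ, C₂ • Wd.quadraticTwist (-(ℓ : ℚ)) = W₂) →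
          Nat.card (W₂.selmerGroup 2) = 1) := by
  have hd0 : (discr K : ℚ) ≠ 0 := by exact_mod_cast NumberField.discr_ne_zero K
  have hSW : Nat.card (W.selmerGroup 2) ≠ 1 := by rw [h4]; norm_num
  have hSWd : Nat.card (Wd.selmerGroup 2) ≠ 1 := by rw [h2]; norm_num
  exact exists_kolyvaginPrime_pow_genusPair_selmer_of_cor34i W h34 hsurj hΔ h4 hK hWd h2 le_rfl
    (exists_selmer_h1Eval_ne_of_card_ne_one W hsurj hSW)
    (exists_selmer_h1Eval_ne_twist_of_card_ne_one W hsurj hd0 hWd hSWd) B₀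

end DepthOne

/-! ## §21 The Kummer reading of non-entanglement: the half-point is moved by `Γ_{ℚ(E[2^M])}` -/

section Kummer

universe u

variable {K : Type u} [Field K] (V : WeierstrassCurve K)

/-- **`[κ(Q), ρ] = ρQ − Q`**: the pairing of a Kummer class `[σ ↦ σQ − Q] ∈ H¹(K, E[n])` (`nQ`
rational) with `ρ ∈ Γ_{K(E[n])}` is the displacement of the division point `Q`. [cite: GrossLMS1991, §9 (pairing after Prop. 9.1)]
[cite: SilvermanAEC2009, VIII.2 (Kummer pairing)] -/
theorem coe_h1Eval_kummerClassTorsion (n : ℤ) (Q : geomPoints V)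
    (hQ : n • Q ∈ MulAction.fixedPoints (absoluteGaloisGroup K) (geomPoints V))
    {ρ : absoluteGaloisGroup K} (hρ : ρ ∈ torsionFixing V n) :
    ((h1Eval V n (V.kummerClassTorsion n Q hQ) ρ : geomTorsion V n) : geomPoints V) = ρ • Q - Q := by
  rw [WeierstrassCurve.kummerClassTorsion, h1Eval_oneCocycleClass _ _ _ hρ,
    WeierstrassCurve.coe_kummerCocycleTorsion_apply]

/-- **NON-ENTANGLEMENT OF A KUMMER CLASS, read on the division point.** For `Q ∈ E(K̄)` with `2Q`
rational and any level `m` with `2 ∣ m`: the Kummer class `κ = [σ ↦ σQ − Q] ∈ H¹(K, E[2])` does not die on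
`Γ_{K(E[m])}` IFF some `h` fixing `E[m]` MOVES `Q` — i.e. iff `Q ∉ E(K(E[m]))`, iff `2Q` is not halvable in
`E(K(E[m]))` (all halves of `2Q` differ by `E[2] ⊆ E(K(E[m]))`). For the LEVEL LAW's twin `A = E^{(d_K)}`
(`#Sel₂(A) = 2`, rank one: `Sel₂(A) = κ(A(ℚ))`) the twin-side hypothesis of
`exists_kolyvaginPrime_pow_genusPair_selmer_of_cor34i` therefore reads: **the generator of `A(ℚ)/2A(ℚ)` is
not halvable over the `2^M`-division field** — the precise meaning of «not entangled» (depthlaw memo §2).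
[cite: SilvermanAEC2009, VIII.2 (Kummer pairing)] [cite: GrossLMS1991, §9 (pairing after Prop. 9.1)] -/
theorem exists_torsionFixing_h1Eval_kummerClassTorsion_ne_iff {m : ℤ} (hm : (2 : ℤ) ∣ m)
    (Q : geomPoints V) (hQ : (2 : ℤ) • Q ∈ MulAction.fixedPoints (absoluteGaloisGroup K) (geomPoints V)) :
    (∃ h ∈ torsionFixing V m, h1Eval V (2 : ℤ) (V.kummerClassTorsion (2 : ℤ) Q hQ) h ≠ 0) ↔
      ∃ h ∈ torsionFixing V m, h • Q ≠ Q := by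
  have hT : torsionFixing V m ≤ torsionFixing V (2 : ℤ) := KolyvaginLowerBoundAtTwo.torsionFixing_le_of_dvd V hm
  have key : ∀ h ∈ torsionFixing V m,
      (h1Eval V (2 : ℤ) (V.kummerClassTorsion (2 : ℤ) Q hQ) h = 0 ↔ h • Q = Q) := fun h hh ↦ by
    rw [← ZeroMemClass.coe_eq_zero, coe_h1Eval_kummerClassTorsion V (2 : ℤ) Q hQ (hT hh), sub_eq_zero]
  constructor
  · rintro ⟨h, hh, hne⟩
    exact ⟨h, hh, fun heq ↦ hne ((key h hh).mpr heq)⟩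
  · rintro ⟨h, hh, hne⟩
    exact ⟨h, hh, fun h0 ↦ hne ((key h hh).mp h0)⟩

end Kummer

/-! ## §22 Point-level form of the twin hypothesis: the half-point of a rational point is moved by `Γ_{ℚ(E[2^M])}` -/

section HalfPoint

variable (W : WeierstrassCurve ℚ) [W.IsElliptic]

omit [W.IsElliptic] in
/-- **Point-level discharge of the twin-side hypothesis.** `Wd` any elliptic model of `W^{(d)}` (`d ≠ 0`),
`P ∈ Wd(ℚ)` with a half `Q ∈ Wd(ℚ̄)` (`2Q = P`), `2 ∣ n`. If some `h ∈ Γ_{ℚ(E[n])}` (torsion of `W`!) MOVES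
`Q`, then the Kummer class `κ(P) ∈ Sel₂(Wd)` does not die on `Γ_{ℚ(E[n])}`: `[κ(P), h] = hQ − Q ≠ 0`
(`Γ_{ℚ(E[n])} ≤ Γ_{ℚ(E[2])} = Γ_{ℚ(E^{(d)}[2])}`). Reading: «`P` is not halvable in `Wd` over `ℚ(E[n])`».
[cite: SilvermanAEC2009, VIII.2 (Kummer pairing) and X.4.2] [cite: MazurRubin2010, Remark 2.4] -/
theorem exists_selmer_h1Eval_ne_twist_of_smul_half_ne {d : ℚ} (hd : d ≠ 0)
    {Wd : WeierstrassCurve ℚ} [Wd.IsElliptic] {C : VariableChange ℚ} (hWd : C • W.quadraticTwist d = Wd)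
    {n : ℤ} (hn : (2 : ℤ) ∣ n) (P : Wd.toAffine.Point) (Q : geomPoints Wd)
    (hQ : (2 : ℤ) • Q = toGeomPoints Wd P) (hmove : ∃ h ∈ torsionFixing W n, h • Q ≠ Q) :
    ∃ c' ∈ Wd.selmerGroup 2, ∃ h ∈ torsionFixing W n, h1Eval Wd (2 : ℤ) c' h ≠ 0 := by
  have hdiv := Wd.zsmul_geomPoints_surjective_of_charZero (n := (2 : ℤ)) two_ne_zero
  obtain ⟨ψ, hψ⟩ := exists_equivariant_addEquiv_geomTorsion_two_of_twist W hd hWd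
  have hTd : torsionFixing W (2 : ℤ) ≤ torsionFixing Wd (2 : ℤ) :=
    torsionFixing_le_of_equivariant_addEquiv Wd W (2 : ℤ) ψ hψ
  have hTn : torsionFixing W n ≤ torsionFixing W (2 : ℤ) := KolyvaginLowerBoundAtTwo.torsionFixing_le_of_dvd W hn
  obtain ⟨h, hh, hmv⟩ := hmove
  refine ⟨WeierstrassCurve.kummerMapTorsion Wd (2 : ℤ) hdiv P, ?_, h, hh, ?_⟩
  · exact (mem_selmerGroup_iff _ _ _).mpr ⟨fun _ ↦ WeierstrassCurve.kummerMapTorsion_mem_selmerLocalKer _ _ _ _ P,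
      fun _ ↦ WeierstrassCurve.kummerMapTorsion_mem_selmerLocalKer _ _ _ _ P⟩
  · rw [WeierstrassCurve.kummerMapTorsion_apply, WeierstrassCurve.kummerMapTorsionFun_eq Wd (2 : ℤ) hdiv P Q hQ]
    intro h0
    apply hmv
    have hc := coe_h1Eval_kummerClassTorsion Wd (2 : ℤ) Q
      (by rw [hQ]; exact WeierstrassCurve.toGeomPoints_mem_fixedPoints Wd P) (hTd (hTn hh))
    rw [h0, ZeroMemClass.coe_zero] at hc
    exact (sub_eq_zero.mp hc.symm)

variable [W.IsGloballyMinimal] {K : Type} [Field K] [NumberField K]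

/-- **CAPSTONE, point-level twin hypothesis.** As `exists_kolyvaginPrime_pow_genusPair_selmer_of_cor34i`, with the
twin-side non-entanglement supplied by a rational point `P ∈ Wd(ℚ)` one (any) half `Q` of which is MOVED by some
element of `Γ_{ℚ(E[2^M])}` — «the twin's point is not halvable over the `2^M`-division field of `E`» (for the LEVEL
LAW's twin, `P` = the generator of `Wd(ℚ)/2`). Modulo cor34i (PRINT) and the `W`-side hypothesis (automatic at
`M = 1`; at `M ≥ 2` implied by `#Sel₂(W) = 4 > #H¹(GL₂(ℤ/2^M), 𝔽₂²) = 2` on the 2-adically surjective habitat — a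
finite group-cohomology count NOT formalised here). BSD is not proved by this.
[cite: MazurRubin2010, Cor. 3.4 (i), Prop. 3.3, Lemma 3.5] [cite: GrossLMS1991, §3 (3.1)–(3.3)]
[cite: SilvermanAEC2009, VIII.2 (Kummer pairing)] -/
theorem exists_kolyvaginPrime_pow_genusPair_selmer_of_cor34i_of_half
    (h34 : MazurRubin2010.cor34i_singleton_rat)
    (hsurj : W.HasSurjectiveModNGaloisRep 2) (hΔ : W.Δ < 0) (h4 : Nat.card (W.selmerGroup 2) = 4)
    (hK : IsImaginaryQuadratic K) {Wd : WeierstrassCurve ℚ} [Wd.IsElliptic] [Wd.IsGloballyMinimal]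
    {C : VariableChange ℚ} (hWd : C • W.quadraticTwist (discr K : ℚ) = Wd)
    (h2 : Nat.card (Wd.selmerGroup 2) = 2) {M : ℕ} (hM : 1 ≤ M)
    (hS : ∃ c ∈ W.selmerGroup 2, ∃ h ∈ torsionFixing W ((2 ^ M : ℕ) : ℤ), h1Eval W (2 : ℤ) c h ≠ 0)
    (P : Wd.toAffine.Point) (Q : geomPoints Wd) (hQ : (2 : ℤ) • Q = toGeomPoints Wd P)
    (hmove : ∃ h ∈ torsionFixing W ((2 ^ M : ℕ) : ℤ), h • Q ≠ Q) (B₀ : Finset ℕ) :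
    ∃ ℓ : ℕ, ∃ _ : Fact ℓ.Prime, ℓ ∉ B₀ ∧ ℓ % 8 = 7 ∧ IsKolyvaginPrime (W.conductorNorm ℤ) W K 2 ℓ ∧
      FrobEqFrobInfty W K (2 ^ M) ℓ ∧ 2 ^ M ∣ ℓ + 1 ∧ ((2 : ℤ) ^ M) ∣ W.frobeniusTrace ℓ ∧
      (∀ (W₁ : WeierstrassCurve ℚ) [W₁.IsElliptic],
        (∃ C₁ : VariableChange ℚ, C₁ • W.quadraticTwist (-(ℓ : ℚ)) = W₁) →
          Nat.card (W₁.selmerGroup 2) = 2) ∧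
      (∀ (W₂ : WeierstrassCurve ℚ) [W₂.IsElliptic],
        (∃ C₂ : VariableChange ℚ, C₂ • Wd.quadraticTwist (-(ℓ : ℚ)) = W₂) →
          Nat.card (W₂.selmerGroup 2) = 1) := by
  have hd0 : (discr K : ℚ) ≠ 0 := by exact_mod_cast NumberField.discr_ne_zero K
  have h2M : (2 : ℤ) ∣ ((2 ^ M : ℕ) : ℤ) := by
    rw [Nat.cast_pow, Nat.cast_ofNat]; exact dvd_pow_self 2 (by omega : M ≠ 0)
  exact exists_kolyvaginPrime_pow_genusPair_selmer_of_cor34i W h34 hsurj hΔ h4 hK hWd h2 hM hS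
    (exists_selmer_h1Eval_ne_twist_of_smul_half_ne W hd0 hWd h2M P Q hQ hmove) B₀

end HalfPoint

end Summit.BirchSwinnertonDyer.BirchSwinnertonDyer.Theorems.GenusKolyTwistingPrime

end
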